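import Mathlib.Analysis.Calculus.Deriv.Mul
import Mathlib.Analysis.Calculus.MeanValue
import Mathlib.MeasureTheory.Integral.Bochner.Set
import Mathlib.MeasureTheory.Group.Arithmetic
import Summits.QuantumFields.YangMills.Theorems.PoincareLipschitzRadialCutoffLetters
import HarnessLib

/-!
# Crux `HistoryTailL` (stmt-QuantumFields-19936), LINE 28 candidate «gross-sd-transfer» —
# LETTERS «THE SMOOTH LOCAL-GOOD CUT-OFF χ_G^∞: PROFILE, PRODUCT SANDWICH, FLOW DERIVATIVE»

Cell `ym3-torus` (YM ladder rung R3 = continuum SU(2) Yang–Mills on T³ — a RUNG, NOT the Clay problem: not d = 4, not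
infinite volume, not a mass gap); WIDTH helper seat `ym3-torus-px8` g9.  Helper `--supports stmt-QuantumFields-19936`;
THEOREMS ONLY (0 `def`, 0 `sorry`, default heartbeats); Mathlib + ✓`PoincareLipschitzRadialCutoffLetters` (§1 profile, cited by
name) only.

WHY.  Pre-filing annex 2 §2 of the card `Cruxes/HistoryTailL/Ideas/gross-sd-transfer.md` (ideator ym-r3-idea-2 g15, after
ym-ust-19936-w8 g9): the Schwinger–Dyson identity needs the observable C¹ along each one-link flow, so the local-good cut-off in the
Grönwall step S_SD cannot be a product of INDICATORS; it is the mollified product `χ_G^∞ := Π_{(i,q)} ψ(dist₁(…)² ∕ θ(K−i)²)`,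
`ψ = 1` on `[0, ¼]`, `ψ = 0` on `[1, ∞)`.  Booked there: (i) the divergence defect (ii′) acquires `∇χ_G^∞ ≤ ‖ψ′‖_∞ ×` (Lipschitz
modulus of the block deviations); (ii) the events of (Q)∕(T) are recovered by the SANDWICH `1_{G(θ∕2)} ≤ χ_G^∞ ≤ 1_{G(θ)}`.  This file
supplies those generic letters in the currency of the (α)∕(β) assembly letters (finite `μ`, bounded measurable weight `0 ≤ χ ≤ 1`).

WHAT IS PROVED (ns `…Theorems.UnitScaleGibbsSmoothCutoffLetters`).
* §1 PROFILE `g_κ(s) = Real.smoothTransition ((1 − s)∕κ)` of ✓`PoincareLipschitzRadialCutoffLetters` §1 (CITED by name, not restated):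
  `cutoff_deriv_eq_zero_of_lt`, ★`cutoff_abs_deriv_le` (`∃ C ≥ 0, ∀ s, |g_κ′(s)| ≤ C`), ★`cutoff_lipschitz`, and the packaged annex-2
  profile at `κ = ¾` ★`exists_annex2_profile` (smooth, antitone, `[0,1]`-valued, `= 1` on `s ≤ ¼`, `= 0` on `1 ≤ s`, `|ψ′| ≤ C`, `C`-Lipschitz).
* §2 PRODUCT CUT-OFF `χ = Π_{i ∈ s} g(Y_i)` for ANY profile `g ∈ [0,1]`, `g = 1` on `(−∞, a]`, `g = 0` on `[b, ∞)`: `prod_profile_nonneg ∕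
  _le_one ∕ _eq_one ∕ _eq_zero ∕ _anti`; POINTWISE SANDWICH ★`indicator_le_prod_profile` ∕ ★`prod_profile_le_indicator`
  (`1_{∀ i, Y_i ≤ a} ≤ χ ≤ 1_{∀ i, Y_i < b}`) + weighted forms (`0 ≤ f`); INTEGRAL SANDWICH ★★`measureReal_le_integral_prod_profile` ∕
  ★★`integral_prod_profile_le_measureReal` (`μ.real{∀ i, Y_i ≤ a} ≤ ∫ χ dμ ≤ μ.real{∀ i, Y_i < b}`, finite `μ`) and
  ★`setIntegral_le_integral_prod_profile_mul` ∕ ★`integral_prod_profile_mul_le_setIntegral` (`∫_{∀ i, Y_i ≤ a} f ≤ ∫ χ·f ≤ ∫_{∀ i, Y_i < b} f`,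
  integrable `f ≥ 0`, any `μ`) = annex 2 §2 (ii).
* §3 FLOW DERIVATIVE ★`hasDerivAt_prod_profile` (`d∕dt Π_i g(y_i(t)) = Σ_i (Π_{j ≠ i} g(y_j))·g′(y_i)·y_i′`), ★★`abs_deriv_prod_profile_le`
  (`|d∕dt χ| ≤ ‖g′‖_∞ · Σ_i |y_i′|`) and the coordinate-LIPSCHITZ form ★★`abs_prod_profile_sub_prod_profile_le`
  (`|χ(y) − χ(y′)| ≤ ‖g′‖_∞ · Σ_i |y_i − y′_i|`) = annex 2 §2 (i).
* §4 THE `dist₁²∕θ²` LETTERING: `sq_div_sq_le_quarter_iff` (`d²∕θ² ≤ ¼ ↔ d ≤ θ∕2`), `sq_div_sq_lt_one_iff` (`d²∕θ² < 1 ↔ d < θ`), and the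
  event sandwich in that lettering ★★`measureReal_halfSmall_le_integral_cutoff` ∕ ★★`integral_cutoff_le_measureReal_small` ∕
  ★`setIntegral_halfSmall_le_le_setIntegral_small` (`μ.real{∀ i, D_i ≤ θ_i∕2} ≤ ∫ Π ψ(D_i²∕θ_i²) dμ ≤ μ.real{∀ i, D_i < θ_i}`).
HONEST SCOPE.  Generic real-analysis ∕ measure letters; the profile is the tree's, cited.  NOTHING of S_SD ∕ S_dom ∕ S_test ∕
«BlockSecondMomentL» ∕ (Q) ∕ K1 ∕ `MeanDeviationL` ∕ `HistoryTailL` ∕ any crux or rung statement is proved or claimed here.  YM₃ on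
T³ is rung R3, not Clay; YM gap NOT proved; no summit statement is proved here.

References: L. Gross, Convergence of U(1)₃ lattice gauge theory to its continuum limit, CMP 92 (1983) 137–162 [GrossCMP1983]
(Thm 2.2: the Schwinger–Dyson ∕ Grönwall Gaussian domination the line transplants); T. Bałaban, Renormalization group approach to
lattice gauge field theories I, CMP 109 (1987) 249–301 [Balaban1987RG1] ((0.18)–(0.20): smooth small-field partitions of unity).
-/

set_option autoImplicit false

noncomputable section

open scoped BigOperators Topology NNReal
open Set Filter MeasureTheory

namespace Summit.QuantumFields.YangMills.Theorems.UnitScaleGibbsSmoothCutoffLetters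
open Summit.QuantumFields.YangMills.Theorems.PoincareLipschitzRadialCutoffLetters

/-! ## §1 The profile `g_κ(s) = smoothTransition((1 − s)∕κ)`: uniform derivative bound and Lipschitz constant -/

/-- `g_κ′ = 0` on `s < 1 − κ` (`g_κ ≡ 1` on that open half-line). [folklore] -/
theorem cutoff_deriv_eq_zero_of_lt {κ s : ℝ} (hκ : 0 < κ) (hs : s < 1 - κ) :
    deriv (fun s : ℝ => Real.smoothTransition ((1 - s) / κ)) s = 0 := by
  have h : (fun s : ℝ => Real.smoothTransition ((1 - s) / κ)) =ᶠ[𝓝 s] fun _ => (1 : ℝ) := by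
    filter_upwards [Iio_mem_nhds hs] with t ht
    exact cutoff_eq_one hκ (le_of_lt ht)
  rw [h.deriv_eq]; simp

/-- ★ Uniform bound on the derivative of the profile: `∃ C ≥ 0, ∀ s, |g_κ′(s)| ≤ C` (`κ > 0`): the derivative is continuous
(`cutoff_deriv_continuous`) and vanishes off the compact interval `[1 − κ, 1]`. [folklore] -/
theorem cutoff_abs_deriv_le {κ : ℝ} (hκ : 0 < κ) :
    ∃ C : ℝ, 0 ≤ C ∧ ∀ s : ℝ, |deriv (fun s : ℝ => Real.smoothTransition ((1 - s) / κ)) s| ≤ C := by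
  obtain ⟨C, hC⟩ := (isCompact_Icc : IsCompact (Icc (1 - κ) (1 : ℝ))).exists_bound_of_continuousOn
    (cutoff_deriv_continuous κ).continuousOn
  refine ⟨max C 0, le_max_right _ _, fun s => ?_⟩
  by_cases h1 : s ∈ Icc (1 - κ) 1
  · have := hC s h1
    rw [Real.norm_eq_abs] at this
    exact this.trans (le_max_left _ _)
  · rw [mem_Icc, not_and_or, not_le, not_le] at h1
    rcases h1 with h | h
    · rw [cutoff_deriv_eq_zero_of_lt hκ h, abs_zero]; exact le_max_right _ _
    · rw [cutoff_deriv_eq_zero hκ h, abs_zero]; exact le_max_right _ _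

/-- ★ The profile is Lipschitz with the same constant: `|g_κ(a) − g_κ(b)| ≤ C·|a − b|`. [folklore] -/
theorem cutoff_lipschitz {κ : ℝ} (hκ : 0 < κ) :
    ∃ C : ℝ, 0 ≤ C ∧ (∀ s : ℝ, |deriv (fun s : ℝ => Real.smoothTransition ((1 - s) / κ)) s| ≤ C) ∧
      ∀ a b : ℝ, |Real.smoothTransition ((1 - a) / κ) - Real.smoothTransition ((1 - b) / κ)| ≤ C * |a - b| := by
  obtain ⟨C, hC0, hC⟩ := cutoff_abs_deriv_le hκ
  refine ⟨C, hC0, hC, fun a b => ?_⟩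
  have hd : Differentiable ℝ (fun s : ℝ => Real.smoothTransition ((1 - s) / κ)) :=
    (cutoff_contDiff κ (n := 1)).differentiable one_ne_zero
  have hL : LipschitzWith (Real.toNNReal C) (fun s : ℝ => Real.smoothTransition ((1 - s) / κ)) := by
    refine lipschitzWith_of_nnnorm_deriv_le hd fun x => ?_
    rw [← NNReal.coe_le_coe, coe_nnnorm, Real.norm_eq_abs, Real.coe_toNNReal _ hC0]
    exact hC x
  have := hL.dist_le_mul a b
  rwa [Real.dist_eq, Real.dist_eq, Real.coe_toNNReal _ hC0] at this

/-- ★ The packaged annex-2 profile (`κ = ¾`): there is a smooth, antitone, `[0,1]`-valued `ψ : ℝ → ℝ` with `ψ = 1` on `s ≤ ¼`,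
`ψ = 0` on `1 ≤ s`, a uniformly bounded derivative and the corresponding Lipschitz bound.  (Witness:
`ψ s = Real.smoothTransition ((1 − s) ∕ (3∕4))`.) [folklore] -/
theorem exists_annex2_profile :
    ∃ ψ : ℝ → ℝ, (∀ n : ℕ∞, ContDiff ℝ n ψ) ∧ Antitone ψ ∧ (∀ s, 0 ≤ ψ s ∧ ψ s ≤ 1) ∧ (∀ s, s ≤ 1 / 4 → ψ s = 1) ∧
      (∀ s, 1 ≤ s → ψ s = 0) ∧
      ∃ C : ℝ, 0 ≤ C ∧ (∀ s, |deriv ψ s| ≤ C) ∧ ∀ a b, |ψ a - ψ b| ≤ C * |a - b| := by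
  have hκ : (0 : ℝ) < 3 / 4 := by norm_num
  obtain ⟨C, hC0, hC, hL⟩ := cutoff_lipschitz hκ
  refine ⟨fun s => Real.smoothTransition ((1 - s) / (3 / 4)), fun n => cutoff_contDiff _, cutoff_antitone hκ,
    fun s => ⟨(cutoff_mem_Icc _ s).1, (cutoff_mem_Icc _ s).2⟩, fun s hs => cutoff_eq_one hκ (by norm_num; linarith),
    fun s hs => cutoff_eq_zero hκ hs, C, hC0, hC, hL⟩

/-! ## §2 The finite product cut-off `χ(y) = Π_{i ∈ s} g(y_i)`: values in `[0,1]`, plateaus, indicator and integral sandwiches -/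

variable {ι : Type*}

/-- `0 ≤ Π g(y_i)` for a `[0,1]`-valued profile. [folklore] -/
theorem prod_profile_nonneg {g : ℝ → ℝ} (hg : ∀ x, g x ∈ Icc (0 : ℝ) 1) (s : Finset ι) (y : ι → ℝ) :
    0 ≤ ∏ i ∈ s, g (y i) :=
  Finset.prod_nonneg fun i _ => (hg (y i)).1

/-- `Π g(y_i) ≤ 1` for a `[0,1]`-valued profile. [folklore] -/
theorem prod_profile_le_one {g : ℝ → ℝ} (hg : ∀ x, g x ∈ Icc (0 : ℝ) 1) (s : Finset ι) (y : ι → ℝ) :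
    ∏ i ∈ s, g (y i) ≤ 1 :=
  Finset.prod_le_one (fun i _ => (hg (y i)).1) fun i _ => (hg (y i)).2

/-- Lower plateau: if every coordinate is `≤ a` (where `g = 1`), the product is `1`. [folklore] -/
theorem prod_profile_eq_one {g : ℝ → ℝ} {a : ℝ} (h1 : ∀ x, x ≤ a → g x = 1) (s : Finset ι) {y : ι → ℝ}
    (hy : ∀ i ∈ s, y i ≤ a) : ∏ i ∈ s, g (y i) = 1 :=
  Finset.prod_eq_one fun i hi => h1 _ (hy i hi)

/-- Upper plateau: if some coordinate is `≥ b` (where `g = 0`), the product is `0`. [folklore] -/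
theorem prod_profile_eq_zero {g : ℝ → ℝ} {b : ℝ} (h0 : ∀ x, b ≤ x → g x = 0) (s : Finset ι) {y : ι → ℝ}
    (hy : ∃ i ∈ s, b ≤ y i) : ∏ i ∈ s, g (y i) = 0 := by
  obtain ⟨i, hi, hyi⟩ := hy
  exact Finset.prod_eq_zero hi (h0 _ hyi)

/-- The product cut-off is coordinatewise antitone for an antitone `[0,1]`-valued profile. [folklore] -/
theorem prod_profile_anti {g : ℝ → ℝ} (hg : ∀ x, g x ∈ Icc (0 : ℝ) 1) (hanti : Antitone g) (s : Finset ι)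
    {y y' : ι → ℝ} (h : ∀ i ∈ s, y i ≤ y' i) : ∏ i ∈ s, g (y' i) ≤ ∏ i ∈ s, g (y i) :=
  Finset.prod_le_prod (fun _ _ => (hg _).1) fun i hi => hanti (h i hi)

variable {Ω : Type*}

/-- ★ Pointwise indicator sandwich, lower half: `1_{∀ i ∈ s, Y_i ω ≤ a} ≤ Π_{i ∈ s} g(Y_i ω)`. [folklore] -/
theorem indicator_le_prod_profile {g : ℝ → ℝ} {a : ℝ} (hg : ∀ x, g x ∈ Icc (0 : ℝ) 1) (h1 : ∀ x, x ≤ a → g x = 1)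
    (s : Finset ι) (Y : ι → Ω → ℝ) (ω : Ω) :
    ({ω | ∀ i ∈ s, Y i ω ≤ a} : Set Ω).indicator (fun _ => (1 : ℝ)) ω ≤ ∏ i ∈ s, g (Y i ω) := by
  by_cases hω : ω ∈ ({ω | ∀ i ∈ s, Y i ω ≤ a} : Set Ω)
  · rw [indicator_of_mem hω, prod_profile_eq_one h1 s hω]
  · rw [indicator_of_notMem hω]; exact prod_profile_nonneg hg s _

/-- ★ Pointwise indicator sandwich, upper half: `Π_{i ∈ s} g(Y_i ω) ≤ 1_{∀ i ∈ s, Y_i ω < b}`. [folklore] -/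
theorem prod_profile_le_indicator {g : ℝ → ℝ} {b : ℝ} (hg : ∀ x, g x ∈ Icc (0 : ℝ) 1) (h0 : ∀ x, b ≤ x → g x = 0)
    (s : Finset ι) (Y : ι → Ω → ℝ) (ω : Ω) :
    ∏ i ∈ s, g (Y i ω) ≤ ({ω | ∀ i ∈ s, Y i ω < b} : Set Ω).indicator (fun _ => (1 : ℝ)) ω := by
  by_cases hω : ω ∈ ({ω | ∀ i ∈ s, Y i ω < b} : Set Ω)
  · rw [indicator_of_mem hω]; exact prod_profile_le_one hg s _
  · rw [indicator_of_notMem hω]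
    simp only [mem_setOf_eq, not_forall, not_lt] at hω
    obtain ⟨i, hi, hyi⟩ := hω
    rw [prod_profile_eq_zero h0 s ⟨i, hi, hyi⟩]

/-- Weighted pointwise sandwich, lower half: `1_{∀ i, Y_i ≤ a}·f ≤ (Π g(Y_i))·f` for `0 ≤ f`. [folklore] -/
theorem indicator_mul_le_prod_profile_mul {g : ℝ → ℝ} {a : ℝ} (hg : ∀ x, g x ∈ Icc (0 : ℝ) 1)
    (h1 : ∀ x, x ≤ a → g x = 1) (s : Finset ι) (Y : ι → Ω → ℝ) {f : Ω → ℝ} (hf : ∀ ω, 0 ≤ f ω) (ω : Ω) :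
    ({ω | ∀ i ∈ s, Y i ω ≤ a} : Set Ω).indicator f ω ≤ (∏ i ∈ s, g (Y i ω)) * f ω := by
  have hind := indicator_mul_left ({ω | ∀ i ∈ s, Y i ω ≤ a} : Set Ω) (fun _ => (1 : ℝ)) f (i := ω)
  simp only [one_mul] at hind
  rw [hind]
  exact mul_le_mul_of_nonneg_right (indicator_le_prod_profile hg h1 s Y ω) (hf ω)

/-- Weighted pointwise sandwich, upper half: `(Π g(Y_i))·f ≤ 1_{∀ i, Y_i < b}·f` for `0 ≤ f`. [folklore] -/
theorem prod_profile_mul_le_indicator_mul {g : ℝ → ℝ} {b : ℝ} (hg : ∀ x, g x ∈ Icc (0 : ℝ) 1)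
    (h0 : ∀ x, b ≤ x → g x = 0) (s : Finset ι) (Y : ι → Ω → ℝ) {f : Ω → ℝ} (hf : ∀ ω, 0 ≤ f ω) (ω : Ω) :
    (∏ i ∈ s, g (Y i ω)) * f ω ≤ ({ω | ∀ i ∈ s, Y i ω < b} : Set Ω).indicator f ω := by
  have hind := indicator_mul_left ({ω | ∀ i ∈ s, Y i ω < b} : Set Ω) (fun _ => (1 : ℝ)) f (i := ω)
  simp only [one_mul] at hind
  rw [hind]
  exact mul_le_mul_of_nonneg_right (prod_profile_le_indicator hg h0 s Y ω) (hf ω)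

variable [MeasurableSpace Ω]

/-- The lower event `{∀ i ∈ s, Y_i ≤ a}` is measurable. [folklore] -/
theorem measurableSet_forall_le (s : Finset ι) {Y : ι → Ω → ℝ} (hY : ∀ i ∈ s, Measurable (Y i)) (a : ℝ) :
    MeasurableSet ({ω | ∀ i ∈ s, Y i ω ≤ a} : Set Ω) := by
  have : ({ω | ∀ i ∈ s, Y i ω ≤ a} : Set Ω) = ⋂ i ∈ s, {ω | Y i ω ≤ a} := by
    ext ω; simp only [mem_setOf_eq, mem_iInter]
  rw [this]
  exact s.measurableSet_biInter fun i hi => measurableSet_le (hY i hi) measurable_const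

/-- The upper event `{∀ i ∈ s, Y_i < b}` is measurable. [folklore] -/
theorem measurableSet_forall_lt (s : Finset ι) {Y : ι → Ω → ℝ} (hY : ∀ i ∈ s, Measurable (Y i)) (b : ℝ) :
    MeasurableSet ({ω | ∀ i ∈ s, Y i ω < b} : Set Ω) := by
  have : ({ω | ∀ i ∈ s, Y i ω < b} : Set Ω) = ⋂ i ∈ s, {ω | Y i ω < b} := by
    ext ω; simp only [mem_setOf_eq, mem_iInter]
  rw [this]
  exact s.measurableSet_biInter fun i hi => measurableSet_lt (hY i hi) measurable_const

/-- The product cut-off is measurable (measurable profile and coordinates). [folklore] -/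
theorem measurable_prod_profile {g : ℝ → ℝ} (hgm : Measurable g) (s : Finset ι) {Y : ι → Ω → ℝ}
    (hY : ∀ i ∈ s, Measurable (Y i)) : Measurable fun ω => ∏ i ∈ s, g (Y i ω) :=
  Finset.measurable_prod s fun i hi => hgm.comp (hY i hi)

/-- The product cut-off is integrable against any finite measure (it is measurable and `[0,1]`-valued). [folklore] -/
theorem integrable_prod_profile {g : ℝ → ℝ} (hg : ∀ x, g x ∈ Icc (0 : ℝ) 1) (hgm : Measurable g) (s : Finset ι)
    {Y : ι → Ω → ℝ} (hY : ∀ i ∈ s, Measurable (Y i)) (μ : Measure Ω) [IsFiniteMeasure μ] :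
    Integrable (fun ω => ∏ i ∈ s, g (Y i ω)) μ := by
  refine Integrable.of_bound (measurable_prod_profile hgm s hY).aestronglyMeasurable 1 (ae_of_all _ fun ω => ?_)
  rw [Real.norm_eq_abs, abs_of_nonneg (prod_profile_nonneg hg s _)]
  exact prod_profile_le_one hg s _

/-- ★★ Integral sandwich, lower half (finite `μ`): `μ.real {∀ i ∈ s, Y_i ≤ a} ≤ ∫ Π g(Y_i) dμ` — the half-threshold event's
mass is recovered from the smooth cut-off. [folklore] -/
theorem measureReal_le_integral_prod_profile {g : ℝ → ℝ} {a : ℝ} (hg : ∀ x, g x ∈ Icc (0 : ℝ) 1)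
    (h1 : ∀ x, x ≤ a → g x = 1) (hgm : Measurable g) (s : Finset ι) {Y : ι → Ω → ℝ}
    (hY : ∀ i ∈ s, Measurable (Y i)) (μ : Measure Ω) [IsFiniteMeasure μ] :
    μ.real ({ω | ∀ i ∈ s, Y i ω ≤ a} : Set Ω) ≤ ∫ ω, ∏ i ∈ s, g (Y i ω) ∂μ := by
  have hA := measurableSet_forall_le s hY a
  rw [← integral_indicator_one hA]
  refine integral_mono ((integrable_const (1 : ℝ)).indicator hA) (integrable_prod_profile hg hgm s hY μ) fun ω => ?_
  exact indicator_le_prod_profile hg h1 s Y ω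

/-- ★★ Integral sandwich, upper half (finite `μ`): `∫ Π g(Y_i) dμ ≤ μ.real {∀ i ∈ s, Y_i < b}` — the smooth cut-off's mass is
dominated by the full-threshold event. [folklore] -/
theorem integral_prod_profile_le_measureReal {g : ℝ → ℝ} {b : ℝ} (hg : ∀ x, g x ∈ Icc (0 : ℝ) 1)
    (h0 : ∀ x, b ≤ x → g x = 0) (hgm : Measurable g) (s : Finset ι) {Y : ι → Ω → ℝ}
    (hY : ∀ i ∈ s, Measurable (Y i)) (μ : Measure Ω) [IsFiniteMeasure μ] :
    ∫ ω, ∏ i ∈ s, g (Y i ω) ∂μ ≤ μ.real ({ω | ∀ i ∈ s, Y i ω < b} : Set Ω) := by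
  have hB := measurableSet_forall_lt s hY b
  rw [← integral_indicator_one hB]
  refine integral_mono (integrable_prod_profile hg hgm s hY μ) ((integrable_const (1 : ℝ)).indicator hB) fun ω => ?_
  exact prod_profile_le_indicator hg h0 s Y ω

/-- The weighted cut-off `(Π g(Y_i))·f` is integrable whenever `f` is. [folklore] -/
theorem integrable_prod_profile_mul {g : ℝ → ℝ} (hg : ∀ x, g x ∈ Icc (0 : ℝ) 1) (hgm : Measurable g) (s : Finset ι)
    {Y : ι → Ω → ℝ} (hY : ∀ i ∈ s, Measurable (Y i)) {μ : Measure Ω} {f : Ω → ℝ} (hf : Integrable f μ) :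
    Integrable (fun ω => (∏ i ∈ s, g (Y i ω)) * f ω) μ := by
  refine hf.bdd_mul (c := 1) (measurable_prod_profile hgm s hY).aestronglyMeasurable (ae_of_all _ fun ω => ?_)
  rw [Real.norm_eq_abs, abs_of_nonneg (prod_profile_nonneg hg s _)]
  exact prod_profile_le_one hg s _

/-- ★ Weighted integral sandwich, lower half (any `μ`, integrable `f ≥ 0`): `∫_{∀ i ∈ s, Y_i ≤ a} f dμ ≤ ∫ (Π g(Y_i))·f dμ` — the
shape in which a tilted∕MGF weight `f = e^{tX}` meets the cut-off. [folklore] -/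
theorem setIntegral_le_integral_prod_profile_mul {g : ℝ → ℝ} {a : ℝ} (hg : ∀ x, g x ∈ Icc (0 : ℝ) 1)
    (h1 : ∀ x, x ≤ a → g x = 1) (hgm : Measurable g) (s : Finset ι) {Y : ι → Ω → ℝ}
    (hY : ∀ i ∈ s, Measurable (Y i)) {μ : Measure Ω} {f : Ω → ℝ} (hf : Integrable f μ) (hf0 : ∀ ω, 0 ≤ f ω) :
    ∫ ω in {ω | ∀ i ∈ s, Y i ω ≤ a}, f ω ∂μ ≤ ∫ ω, (∏ i ∈ s, g (Y i ω)) * f ω ∂μ := by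
  have hA := measurableSet_forall_le s hY a
  rw [← integral_indicator hA]
  exact integral_mono (hf.indicator hA) (integrable_prod_profile_mul hg hgm s hY hf)
    fun ω => indicator_mul_le_prod_profile_mul hg h1 s Y hf0 ω

/-- ★ Weighted integral sandwich, upper half (any `μ`, integrable `f ≥ 0`): `∫ (Π g(Y_i))·f dμ ≤ ∫_{∀ i ∈ s, Y_i < b} f dμ`.
[folklore] -/
theorem integral_prod_profile_mul_le_setIntegral {g : ℝ → ℝ} {b : ℝ} (hg : ∀ x, g x ∈ Icc (0 : ℝ) 1)
    (h0 : ∀ x, b ≤ x → g x = 0) (hgm : Measurable g) (s : Finset ι) {Y : ι → Ω → ℝ}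
    (hY : ∀ i ∈ s, Measurable (Y i)) {μ : Measure Ω} {f : Ω → ℝ} (hf : Integrable f μ) (hf0 : ∀ ω, 0 ≤ f ω) :
    ∫ ω, (∏ i ∈ s, g (Y i ω)) * f ω ∂μ ≤ ∫ ω in {ω | ∀ i ∈ s, Y i ω < b}, f ω ∂μ := by
  have hB := measurableSet_forall_lt s hY b
  rw [← integral_indicator hB]
  exact integral_mono (integrable_prod_profile_mul hg hgm s hY hf) (hf.indicator hB)
    fun ω => prod_profile_mul_le_indicator_mul hg h0 s Y hf0 ω

/-! ## §3 The flow derivative and the coordinate-Lipschitz bound of the product cut-off -/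

/-- ★ Derivative of the product cut-off along differentiable coordinate paths:
`d∕dt Π_{i ∈ s} g(y_i(t)) = Σ_{i ∈ s} (Π_{j ∈ s ∖ {i}} g(y_j(t))) · (g′(y_i(t)) · y_i′(t))`. [folklore] -/
theorem hasDerivAt_prod_profile [DecidableEq ι] {g : ℝ → ℝ} (hgd : Differentiable ℝ g) (s : Finset ι)
    {y : ι → ℝ → ℝ} {y' : ι → ℝ} {t : ℝ} (hy : ∀ i ∈ s, HasDerivAt (y i) (y' i) t) :
    HasDerivAt (fun t => ∏ i ∈ s, g (y i t))
      (∑ i ∈ s, (∏ j ∈ s.erase i, g (y j t)) * (deriv g (y i t) * y' i)) t := by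
  have h := HasDerivAt.fun_finsetProd (u := s) (f := fun i t => g (y i t))
    (f' := fun i => deriv g (y i t) * y' i) (x := t) fun i hi => ((hgd (y i t)).hasDerivAt).comp t (hy i hi)
  simpa only [smul_eq_mul] using h

/-- The derivative sum is bounded by `‖g′‖_∞ · Σ_i |y_i′|` (each co-factor product lies in `[0,1]`). [folklore] -/
theorem abs_sum_erase_prod_mul_le [DecidableEq ι] {g : ℝ → ℝ} (hg : ∀ x, g x ∈ Icc (0 : ℝ) 1) {C : ℝ}
    (hC : ∀ x, |deriv g x| ≤ C) (s : Finset ι) (y : ι → ℝ) (y' : ι → ℝ) :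
    |∑ i ∈ s, (∏ j ∈ s.erase i, g (y j)) * (deriv g (y i) * y' i)| ≤ C * ∑ i ∈ s, |y' i| := by
  calc |∑ i ∈ s, (∏ j ∈ s.erase i, g (y j)) * (deriv g (y i) * y' i)|
      ≤ ∑ i ∈ s, |(∏ j ∈ s.erase i, g (y j)) * (deriv g (y i) * y' i)| := Finset.abs_sum_le_sum_abs _ _
    _ ≤ ∑ i ∈ s, C * |y' i| := by
        refine Finset.sum_le_sum fun i _ => ?_
        rw [abs_mul, abs_mul, abs_of_nonneg (prod_profile_nonneg hg _ _)]
        have h1 : ∏ j ∈ s.erase i, g (y j) ≤ 1 := prod_profile_le_one hg _ _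
        have h0 : 0 ≤ ∏ j ∈ s.erase i, g (y j) := prod_profile_nonneg hg _ _
        calc (∏ j ∈ s.erase i, g (y j)) * (|deriv g (y i)| * |y' i|)
            ≤ 1 * (C * |y' i|) :=
              mul_le_mul h1 (mul_le_mul_of_nonneg_right (hC _) (abs_nonneg _))
                (mul_nonneg (abs_nonneg _) (abs_nonneg _)) zero_le_one
          _ = C * |y' i| := one_mul _
    _ = C * ∑ i ∈ s, |y' i| := (Finset.mul_sum _ _ _).symm

/-- ★★ The flow-derivative bound of the product cut-off: `|d∕dt Π_{i ∈ s} g(y_i(t))| ≤ ‖g′‖_∞ · Σ_{i ∈ s} |y_i′(t)|` — annex 2 §2 (i):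
the `∇χ_G^∞`-defect costs `‖ψ′‖_∞` times the sum of the speeds of the (normalised, squared) block deviations along the one-link
flow. [folklore] -/
theorem abs_deriv_prod_profile_le [DecidableEq ι] {g : ℝ → ℝ} (hgd : Differentiable ℝ g) (hg : ∀ x, g x ∈ Icc (0 : ℝ) 1)
    {C : ℝ} (hC : ∀ x, |deriv g x| ≤ C) (s : Finset ι) {y : ι → ℝ → ℝ} {y' : ι → ℝ} {t : ℝ}
    (hy : ∀ i ∈ s, HasDerivAt (y i) (y' i) t) :
    |deriv (fun t => ∏ i ∈ s, g (y i t)) t| ≤ C * ∑ i ∈ s, |y' i| := by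
  rw [(hasDerivAt_prod_profile hgd s hy).deriv]
  exact abs_sum_erase_prod_mul_le hg hC s (fun i => y i t) y'

/-- ★★ The coordinate-Lipschitz bound of the product cut-off: for a `[0,1]`-valued profile with `|g(a) − g(b)| ≤ C|a − b|`,
`|Π_{i ∈ s} g(y_i) − Π_{i ∈ s} g(y′_i)| ≤ C · Σ_{i ∈ s} |y_i − y′_i|` (telescoping, every partial product in `[0,1]`). [folklore] -/
theorem abs_prod_profile_sub_prod_profile_le {g : ℝ → ℝ} (hg : ∀ x, g x ∈ Icc (0 : ℝ) 1) {C : ℝ} (hC0 : 0 ≤ C)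
    (hL : ∀ a b : ℝ, |g a - g b| ≤ C * |a - b|) (s : Finset ι) (y y' : ι → ℝ) :
    |∏ i ∈ s, g (y i) - ∏ i ∈ s, g (y' i)| ≤ C * ∑ i ∈ s, |y i - y' i| := by
  induction s using Finset.cons_induction with
  | empty => simp
  | cons a s ha ih =>
    rw [Finset.prod_cons, Finset.prod_cons, Finset.sum_cons, mul_add]
    have hP0 : 0 ≤ ∏ i ∈ s, g (y i) := prod_profile_nonneg hg _ _
    have hP1 : ∏ i ∈ s, g (y i) ≤ 1 := prod_profile_le_one hg _ _
    have hga0 : 0 ≤ g (y' a) := (hg _).1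
    have hga1 : g (y' a) ≤ 1 := (hg _).2
    calc |g (y a) * ∏ i ∈ s, g (y i) - g (y' a) * ∏ i ∈ s, g (y' i)|
        = |(g (y a) - g (y' a)) * ∏ i ∈ s, g (y i) + g (y' a) * (∏ i ∈ s, g (y i) - ∏ i ∈ s, g (y' i))| := by
          ring_nf
      _ ≤ |(g (y a) - g (y' a)) * ∏ i ∈ s, g (y i)| + |g (y' a) * (∏ i ∈ s, g (y i) - ∏ i ∈ s, g (y' i))| :=
          abs_add_le _ _
      _ = |g (y a) - g (y' a)| * (∏ i ∈ s, g (y i)) + g (y' a) * |∏ i ∈ s, g (y i) - ∏ i ∈ s, g (y' i)| := by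
          rw [abs_mul, abs_mul, abs_of_nonneg hP0, abs_of_nonneg hga0]
      _ ≤ C * |y a - y' a| * 1 + 1 * (C * ∑ i ∈ s, |y i - y' i|) :=
          add_le_add (mul_le_mul (hL _ _) hP1 hP0 (mul_nonneg hC0 (abs_nonneg _)))
            (mul_le_mul hga1 ih (abs_nonneg _) zero_le_one)
      _ = C * |y a - y' a| + C * ∑ i ∈ s, |y i - y' i| := by ring

/-! ## §4 The `dist₁²∕θ²` lettering of annex 2: thresholds `¼ ↔ θ∕2` and `1 ↔ θ`, and the event sandwich in that lettering -/

/-- `d²∕θ² ≤ ¼ ↔ d ≤ θ∕2` for `0 ≤ d`, `0 < θ`. [folklore] -/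
theorem sq_div_sq_le_quarter_iff {d θ : ℝ} (hd : 0 ≤ d) (hθ : 0 < θ) : d ^ 2 / θ ^ 2 ≤ 1 / 4 ↔ d ≤ θ / 2 := by
  rw [div_le_iff₀ (pow_pos hθ 2), show (1 : ℝ) / 4 * θ ^ 2 = (θ / 2) ^ 2 by ring,
    pow_le_pow_iff_left₀ hd (by positivity) two_ne_zero]

/-- `d²∕θ² < 1 ↔ d < θ` for `0 ≤ d`, `0 < θ`. [folklore] -/
theorem sq_div_sq_lt_one_iff {d θ : ℝ} (hd : 0 ≤ d) (hθ : 0 < θ) : d ^ 2 / θ ^ 2 < 1 ↔ d < θ := by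
  rw [div_lt_one (pow_pos hθ 2), pow_lt_pow_iff_left₀ hd hθ.le two_ne_zero]

omit [MeasurableSpace Ω] in
/-- The half-threshold event in the `dist₁²∕θ²` lettering: `{∀ i, D_i ≤ θ_i∕2} = {∀ i, D_i²∕θ_i² ≤ ¼}` (`D ≥ 0`, `θ > 0`). [folklore] -/
theorem setOf_forall_le_half_eq (s : Finset ι) {D : ι → Ω → ℝ} (hD0 : ∀ i ∈ s, ∀ ω, 0 ≤ D i ω) {θ : ι → ℝ}
    (hθ : ∀ i ∈ s, 0 < θ i) :
    ({ω | ∀ i ∈ s, D i ω ≤ θ i / 2} : Set Ω) = {ω | ∀ i ∈ s, D i ω ^ 2 / θ i ^ 2 ≤ 1 / 4} := by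
  ext ω; simp only [mem_setOf_eq]
  exact forall₂_congr fun i hi => (sq_div_sq_le_quarter_iff (hD0 i hi ω) (hθ i hi)).symm

omit [MeasurableSpace Ω] in
/-- The full-threshold event in the `dist₁²∕θ²` lettering: `{∀ i, D_i < θ_i} = {∀ i, D_i²∕θ_i² < 1}` (`D ≥ 0`, `θ > 0`). [folklore] -/
theorem setOf_forall_lt_eq (s : Finset ι) {D : ι → Ω → ℝ} (hD0 : ∀ i ∈ s, ∀ ω, 0 ≤ D i ω) {θ : ι → ℝ}
    (hθ : ∀ i ∈ s, 0 < θ i) :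
    ({ω | ∀ i ∈ s, D i ω < θ i} : Set Ω) = {ω | ∀ i ∈ s, D i ω ^ 2 / θ i ^ 2 < 1} := by
  ext ω; simp only [mem_setOf_eq]
  exact forall₂_congr fun i hi => (sq_div_sq_lt_one_iff (hD0 i hi ω) (hθ i hi)).symm

/-- ★★ Annex 2 §2 (ii), lower half, in the card's lettering: for a `[0,1]`-valued measurable profile with `g = 1` on `s ≤ ¼`,
nonnegative measurable deviations `D_i` and thresholds `θ_i > 0`,
`μ.real {∀ i ∈ s, D_i ≤ θ_i∕2} ≤ ∫ Π_{i ∈ s} g(D_i²∕θ_i²) dμ` — the mass of the HALF-threshold good event `G(θ∕2)` is bounded by the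
smooth cut-off's integral. [folklore] -/
theorem measureReal_halfSmall_le_integral_cutoff {g : ℝ → ℝ} (hg : ∀ x, g x ∈ Icc (0 : ℝ) 1)
    (h1 : ∀ x, x ≤ 1 / 4 → g x = 1) (hgm : Measurable g) (s : Finset ι) {D : ι → Ω → ℝ}
    (hD : ∀ i ∈ s, Measurable (D i)) (hD0 : ∀ i ∈ s, ∀ ω, 0 ≤ D i ω) {θ : ι → ℝ} (hθ : ∀ i ∈ s, 0 < θ i)
    (μ : Measure Ω) [IsFiniteMeasure μ] :
    μ.real ({ω | ∀ i ∈ s, D i ω ≤ θ i / 2} : Set Ω) ≤ ∫ ω, ∏ i ∈ s, g (D i ω ^ 2 / θ i ^ 2) ∂μ := by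
  have hY : ∀ i ∈ s, Measurable (fun ω => D i ω ^ 2 / θ i ^ 2) := fun i hi => ((hD i hi).pow_const 2).div_const _
  rw [setOf_forall_le_half_eq s hD0 hθ]
  exact measureReal_le_integral_prod_profile hg h1 hgm s (Y := fun i ω => D i ω ^ 2 / θ i ^ 2) hY μ

/-- ★★ Annex 2 §2 (ii), upper half, in the card's lettering: with `g = 0` on `1 ≤ s`,
`∫ Π_{i ∈ s} g(D_i²∕θ_i²) dμ ≤ μ.real {∀ i ∈ s, D_i < θ_i}` — the smooth cut-off's integral is bounded by the mass of the FULL-threshold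
good event `G(θ)`. [folklore] -/
theorem integral_cutoff_le_measureReal_small {g : ℝ → ℝ} (hg : ∀ x, g x ∈ Icc (0 : ℝ) 1)
    (h0 : ∀ x, 1 ≤ x → g x = 0) (hgm : Measurable g) (s : Finset ι) {D : ι → Ω → ℝ}
    (hD : ∀ i ∈ s, Measurable (D i)) (hD0 : ∀ i ∈ s, ∀ ω, 0 ≤ D i ω) {θ : ι → ℝ} (hθ : ∀ i ∈ s, 0 < θ i)
    (μ : Measure Ω) [IsFiniteMeasure μ] :
    ∫ ω, ∏ i ∈ s, g (D i ω ^ 2 / θ i ^ 2) ∂μ ≤ μ.real ({ω | ∀ i ∈ s, D i ω < θ i} : Set Ω) := by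
  have hY : ∀ i ∈ s, Measurable (fun ω => D i ω ^ 2 / θ i ^ 2) := fun i hi => ((hD i hi).pow_const 2).div_const _
  rw [setOf_forall_lt_eq s hD0 hθ]
  exact integral_prod_profile_le_measureReal hg h0 hgm s (Y := fun i ω => D i ω ^ 2 / θ i ^ 2) hY μ

/-- ★ The weighted sandwich in the card's lettering (any `μ`, integrable `f ≥ 0`, e.g. `f = e^{tX}`):
`∫_{∀ i, D_i ≤ θ_i∕2} f ≤ ∫ (Π g(D_i²∕θ_i²))·f ≤ ∫_{∀ i, D_i < θ_i} f`. [folklore] -/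
theorem setIntegral_halfSmall_le_le_setIntegral_small {g : ℝ → ℝ} (hg : ∀ x, g x ∈ Icc (0 : ℝ) 1)
    (h1 : ∀ x, x ≤ 1 / 4 → g x = 1) (h0 : ∀ x, 1 ≤ x → g x = 0) (hgm : Measurable g) (s : Finset ι)
    {D : ι → Ω → ℝ} (hD : ∀ i ∈ s, Measurable (D i)) (hD0 : ∀ i ∈ s, ∀ ω, 0 ≤ D i ω) {θ : ι → ℝ}
    (hθ : ∀ i ∈ s, 0 < θ i) {μ : Measure Ω} {f : Ω → ℝ} (hf : Integrable f μ) (hf0 : ∀ ω, 0 ≤ f ω) :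
    ∫ ω in {ω | ∀ i ∈ s, D i ω ≤ θ i / 2}, f ω ∂μ ≤ ∫ ω, (∏ i ∈ s, g (D i ω ^ 2 / θ i ^ 2)) * f ω ∂μ ∧
      ∫ ω, (∏ i ∈ s, g (D i ω ^ 2 / θ i ^ 2)) * f ω ∂μ ≤ ∫ ω in {ω | ∀ i ∈ s, D i ω < θ i}, f ω ∂μ := by
  have hY : ∀ i ∈ s, Measurable (fun ω => D i ω ^ 2 / θ i ^ 2) := fun i hi => ((hD i hi).pow_const 2).div_const _
  refine ⟨?_, ?_⟩
  · rw [setOf_forall_le_half_eq s hD0 hθ]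
    exact setIntegral_le_integral_prod_profile_mul hg h1 hgm s (Y := fun i ω => D i ω ^ 2 / θ i ^ 2) hY hf hf0
  · rw [setOf_forall_lt_eq s hD0 hθ]
    exact integral_prod_profile_mul_le_setIntegral hg h0 hgm s (Y := fun i ω => D i ω ^ 2 / θ i ^ 2) hY hf hf0

end Summit.QuantumFields.YangMills.Theorems.UnitScaleGibbsSmoothCutoffLetters

end
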